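import Literature.MathematicalPhysics.QuantumLattice.HubbardOpenBoxWeightedTPPClusterOracle
import Literature.MathematicalPhysics.QuantumLattice.HubbardTPPWeightedClusterFloorSplit
import HarnessLib

/-!
# The weighted `t–t'–t''` cluster oracle with a SPLIT third-neighbour amplitude: kernel certificates at ANY axial
# weight `A/Q` ⇒ object-M floors `2m − 12μρ + |t'' − 2A/Q|·ℓ ≤ e^M`

Topic `MathematicalPhysics/QuantumLattice`, family `hubbard` (seat hubbard-box-p3, S2, hypothesis-free tier). The packaged
form `OccupationCode.tiGroundEnergyDensityAt_tpp_ge_of_weightedTppKCerts_2x3` (`HubbardOpenBoxWeightedTPPClusterOracle`,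
hubbard-box-p2) reads kernel certificates of the weighted `2 × 3` `t–t'–t''` cluster at the EXACT axial weight `2A = t''·Q`.
This file is its companion for a GENERAL integer axial weight `A`: the cluster carries the share `2A/Q` of `t''` exactly and
the remainder `|t'' − 2A/Q|` is priced by the dressed doubling allowance of
`InfVolFermionState.tiGroundEnergyDensityAt_tpp_ge_of_boxFloorsW_2x3_split` (`HubbardTPPWeightedClusterFloorSplit`):

* **`tiGroundEnergyDensityAt_tpp_ge_of_weightedTppKCerts_2x3_split`** — floor table `σ k ≤ E₀(h^{W,tt't''}_{2×3}(symW W₀/Q, V/Q, M/Q; A/Q), k)`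
  (`k ≤ 12`, e.g. `groundEnergy_ge_of_kCertsWT₃`), the integer identities `wsumVCode + wsumHCode = t·Q`, `2·wsumD₁Code = t'·Q`,
  `2·wsumD₂Code = t'·Q`, `Σ M = 0`, the `U`-budget `2·Σ V + |t'' − 2A/Q|·V'·Q = U·Q` with `V' ≥ 0`, a supporting line
  `m ≤ σ k + μk` and a floor `ℓ ≤ e(1, 0, V'; ρ)` of the nearest-neighbour model give
  `2m − 12μρ + |t'' − 2A/Q|·ℓ ≤ e^M(t, t', t'', U; ρ)` (`0 < ρ < 2`);
* **`tiGroundEnergyDensityAt_tpp_ge_of_weightedTppKCerts_2x3_split_free`** — the `V' = 0` reading (`2·Σ V = U·Q`, `ℓ ≤ e(1, 0, 0; ρ)`,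
  e.g. the tree's free Fermi-sea rows / `energyDensityTT'_ge_bathtub`).

`A = t''Q/2` recovers the exact packaged law (remainder `0`); `A = 0` is the kinematic word of a weighted `t–t'` table. WHY: for third-neighbour
ratios `|t''/t'| ≳ 0.2` an interior share beats both ends (seat table SPLIT-T3-2x3-g17: `+0.05…0.09 t` on the `U_lo` faces of the typed
object-M boxes), and the certificate emitter needs the row by name. Everything is PROVED; no definition, no named fact, no number.

## Mathlib / tree search

REUSED: `InfVolFermionState.tiGroundEnergyDensityAt_tpp_ge_of_boxFloorsW_2x3_split` (HubbardTPPWeightedClusterFloorSplit);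
`symW`, `symW_symm`, `wsumV_siteRank_div`, `wsumH_siteRank_div`, `wsumD₁_siteRank_div`, `wsumD₂_siteRank_div`, `sum_siteRank_div`
(HubbardOpenBoxWeightedClusterOracle / …Sums). `lean search 'weightedTppKCerts'` (2026-08-28): only the exact form.

## References

* R. Valentí, J. Stolze, P. J. Hirschfeld, Phys. Rev. B 43 (1991) 13743, §II. [cite: ValentiStolzeHirschfeld1991, §II]
* P. W. Anderson, Phys. Rev. 83 (1951) 1260, eq. (2). [cite: Anderson1951, eq. (2)]
* E. Pavarini et al., PRL 87 (2001) 047003, eq. (1). [cite: PavariniEtAl2001, eq. (1)]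
-/

noncomputable section

namespace Literature.MathematicalPhysics.QuantumLattice

namespace OccupationCode

open Finset Matrix HubbardWave0 ClusterLowerBound ThermodynamicLimit Literature.Computation.Certificates

/-- **Weighted `2 × 3` Anderson bound for OBJECT M from kernel certificates with a SPLIT third-neighbour amplitude.** For integer
tables `W₀` (symmetrised by `symW`), `V`, `M`, ANY integer axial weight `A` and `Q > 0`: a floor table
`σ k ≤ E₀(h^{W,tt't''}_{2×3}(symW W₀/Q, V/Q, M/Q; A/Q), k)` (`k ≤ 12`), the integer identities `wsumVCode + wsumHCode = t·Q`,
`2·wsumD₁Code = t'·Q`, `2·wsumD₂Code = t'·Q`, `Σ M = 0`, the budget `2·Σ V + |t'' − 2A/Q|·V'·Q = U·Q` (`V' ≥ 0`), a supporting line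
`m ≤ σ k + μk` and `ℓ ≤ e(1, 0, V'; ρ)` give `2m − 12μρ + |t'' − 2A/Q|·ℓ ≤ e^M(t, t', t'', U; ρ)` for `0 < ρ < 2`.
[cite: ValentiStolzeHirschfeld1991, §II] [cite: Anderson1951, eq. (2)] [cite: PavariniEtAl2001, eq. (1)] -/
theorem tiGroundEnergyDensityAt_tpp_ge_of_weightedTppKCerts_2x3_split (W₀ : ℕ → ℕ → ℤ) (V M : ℕ → ℤ) (A : ℤ) {Q : ℕ}
    (hQ : 0 < Q) {σ : ℕ → ℝ} {t t' t'' U V' ℓ : ℝ}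
    (hF : ∀ k ≤ 12, σ k ≤ groundEnergy (hubbardOpenBoxTT'T''W 2 3
      (fun x y => (symW W₀ (siteRank x) (siteRank y) : ℝ) / Q) (fun x => (V (siteRank x) : ℝ) / Q)
      (fun x => (M (siteRank x) : ℝ) / Q) ((A : ℝ) / Q)) k)
    (ht : ((wsumVCode 3 6 (symW W₀) + wsumHCode 3 6 (symW W₀) : ℤ) : ℝ) = t * Q)
    (hd₁ : ((2 * wsumD₁Code 3 6 (symW W₀) : ℤ) : ℝ) = t' * Q) (hd₂ : ((2 * wsumD₂Code 3 6 (symW W₀) : ℤ) : ℝ) = t' * Q)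
    (hV' : 0 ≤ V') (hU : ((2 * sumNat V 6 : ℤ) : ℝ) + |t'' - 2 * ((A : ℝ) / Q)| * V' * Q = U * Q) (hν : sumNat M 6 = 0)
    (μ m : ℝ) (hm : ∀ k ≤ 12, m ≤ σ k + μ * k) {ρ : ℝ} (hℓ : ℓ ≤ energyDensityTT' 1 0 V' ρ)
    (hρ0 : 0 < ρ) (hρ2 : ρ < 2) :
    2 * m - 12 * μ * ρ + |t'' - 2 * ((A : ℝ) / Q)| * ℓ ≤
      (hubbardTT'T''FermionInteraction t t' t'' U).tiGroundEnergyDensityAt 2 ρ := by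
  have hQ' : (Q : ℝ) ≠ 0 := by exact_mod_cast hQ.ne'
  refine InfVolFermionState.tiGroundEnergyDensityAt_tpp_ge_of_boxFloorsW_2x3_split (fun x y => by rw [symW_symm])
    ?_ ?_ ?_ hV' ?_ ?_ hF μ m hm hℓ hρ0 hρ2
  · rw [wsumV_siteRank_div, wsumH_siteRank_div, ← add_div, div_eq_iff hQ']
    exact_mod_cast ht
  · rw [wsumD₁_siteRank_div, mul_div_assoc', div_eq_iff hQ']
    exact_mod_cast hd₁
  · rw [wsumD₂_siteRank_div, mul_div_assoc', div_eq_iff hQ']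
    exact_mod_cast hd₂
  · have h1 : (2 : ℝ) * ∑ x : Fin 2 ×ₗ Fin 3, (V (siteRank x) : ℝ) / Q = ((2 * sumNat V 6 : ℤ) : ℝ) / Q := by
      rw [sum_siteRank_div, show (2 * 3 : ℕ) = 6 from rfl]
      push_cast
      ring
    rw [h1, div_add' _ _ _ hQ', div_eq_iff hQ']
    linarith
  · rw [sum_siteRank_div, show (2 * 3 : ℕ) = 6 from rfl, hν]
    simp

/-- **The `V' = 0` reading**: cluster budget `2·Σ V = U·Q`, remainder priced by a free-band floor `ℓ ≤ e(1, 0, 0; ρ)`: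
`2m − 12μρ + |t'' − 2A/Q|·ℓ ≤ e^M(t, t', t'', U; ρ)`. [cite: ValentiStolzeHirschfeld1991, §II] [cite: Anderson1951, eq. (2)] -/
theorem tiGroundEnergyDensityAt_tpp_ge_of_weightedTppKCerts_2x3_split_free (W₀ : ℕ → ℕ → ℤ) (V M : ℕ → ℤ) (A : ℤ) {Q : ℕ}
    (hQ : 0 < Q) {σ : ℕ → ℝ} {t t' t'' U ℓ : ℝ}
    (hF : ∀ k ≤ 12, σ k ≤ groundEnergy (hubbardOpenBoxTT'T''W 2 3
      (fun x y => (symW W₀ (siteRank x) (siteRank y) : ℝ) / Q) (fun x => (V (siteRank x) : ℝ) / Q)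
      (fun x => (M (siteRank x) : ℝ) / Q) ((A : ℝ) / Q)) k)
    (ht : ((wsumVCode 3 6 (symW W₀) + wsumHCode 3 6 (symW W₀) : ℤ) : ℝ) = t * Q)
    (hd₁ : ((2 * wsumD₁Code 3 6 (symW W₀) : ℤ) : ℝ) = t' * Q) (hd₂ : ((2 * wsumD₂Code 3 6 (symW W₀) : ℤ) : ℝ) = t' * Q)
    (hU : ((2 * sumNat V 6 : ℤ) : ℝ) = U * Q) (hν : sumNat M 6 = 0)
    (μ m : ℝ) (hm : ∀ k ≤ 12, m ≤ σ k + μ * k) {ρ : ℝ} (hℓ : ℓ ≤ energyDensityTT' 1 0 0 ρ)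
    (hρ0 : 0 < ρ) (hρ2 : ρ < 2) :
    2 * m - 12 * μ * ρ + |t'' - 2 * ((A : ℝ) / Q)| * ℓ ≤
      (hubbardTT'T''FermionInteraction t t' t'' U).tiGroundEnergyDensityAt 2 ρ :=
  tiGroundEnergyDensityAt_tpp_ge_of_weightedTppKCerts_2x3_split W₀ V M A hQ hF ht hd₁ hd₂ le_rfl
    (by rw [mul_zero, zero_mul, add_zero]; exact hU) hν μ m hm hℓ hρ0 hρ2

end OccupationCode

end Literature.MathematicalPhysics.QuantumLattice

end
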